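import Literature.AlgebraicGeometry.Frobenioids.PerfectionCoAngular
import Literature.AlgebraicGeometry.Frobenioids.NaiveFrobeniusDescent
import HarnessLib

/-!
# Frobenioids I, Proposition 3.2 (iii), the core of "`C^pf ≃ (C^pf)^pf`": for a Frobenioid of
# PERFECT type the natural functor `C → C^pf` is an equivalence (PROOFS)

Mochizuki, *The geometry of Frobenioids I: the general theory*, Kyushu J. Math. **62** (2008),
Definition 1.2 (iv) "perfect" p. 23, Proposition 2.1 (iii) p. 44, Definition 3.1 (iii) p. 57,
Proposition 3.2 (iii) p. 59 [cite: MochizukiFrdI2008, Prop. 3.2 (iii) p.59]: "Moreover, there is a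
natural equivalence of categories `C^pf ⥲ (C^pf)^pf`." The natural functor in question is the functor
`A ↦ (A, 1)` of Def. 3.1 (iii) for the (perfect, Prop. 3.2 (iii)) Frobenioid `C^pf`; the present file
proves the general statement behind it (abc-iut cell, row `FrdI:Prop3.2(iii)-(c)-core`, L1-lead R37):

* `toPf_faithful`, `toPf_full`, `toPf_essSurj`, `toPf_isEquivalence`: **for a Frobenioid `C` of
  perfect type, `Perfection.toPf hF : C ⥤ C^pf` is an equivalence of categories** — no
  Frobenius-isotropic hypothesis is needed, exactly as in Prop. 2.1 (iii) (whose descent lemmas,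
  `NaiveFrobeniusDescent.lean`, seat abc-iut-L1-d7, carry the argument: a perfected morphism
  `(A, 1) → (B, 1)` is represented by some `θ : A^{(a)} → B^{(a)}`, which DESCENDS along the chosen
  Frobenius-type arrows `A → A^{(a)}`, `B → B^{(a)}` (`exists_descent` = fullness); two arrows of `C`
  with the same image agree after composition with some `B → B^{(b)}` of Frobenius type, which is
  right-cancellable (`cancel_frobeniusType` = faithfulness); and `(B, m) ≅ (A, 1)` for any `m`-th root
  `A → B` of `B`, by the essential uniqueness of Frobenius-type arrows, Def. 1.3 (ii)).

Proof-only companion of abc-iut-L1-d9's construction of `C^pf` (`Perfection.lean`, `PerfectionCategory.lean`,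
`PerfectionCoAngular.lean`). No new definitions.
-/

namespace Literature.AlgebraicGeometry.Frobenioids

namespace PreFrobenioid

namespace Perfection

open CategoryTheory Opposite

universe w v v' u u'

variable {D : Type u} [Category.{v} D] {Φ : Dᵒᵖ ⥤ CommMonCat.{w}}
  {C : Type u'} [Category.{v'} C] {F : C ⥤ ElemFrobenioid Φ} {hF : IsFrobenioid F}

/-! ### Faithfulness -/

/-- Unwinding an equality `toPf φ = toPf χ` in `C^pf`: the two arrows of `C` agree after composition
with a chosen arrow of Frobenius type out of the codomain (the classes agree at some level `(a, b)`,
i.e. the conjugates of `φ`, `χ` along `A → A^{(1)} → A^{(a)}`, `B → B^{(1)} → B^{(b)}` coincide).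
[cite: MochizukiFrdI2008, Def. 3.1 (ii) p.56] -/
theorem exists_comp_frob_eq_of_map_eq {A B : C} {φ χ : A ⟶ B} (h : (toPf hF).map φ = (toPf hF).map χ) :
    ∃ b : ℕ+, φ ≫ frob hF B b = χ ≫ frob hF B b := by
  obtain ⟨M, hr, hs, e⟩ := Hom.mk_eq_mk.mp h
  refine ⟨M.b, ?_⟩
  have key : ∀ ψ : A ⟶ B, ψ ≫ frob hF B M.b =
      frob hF A 1 ≫ frobTrans hF A hr.1 ≫ Level.lift (toPfRep hF ψ).L M hr (toPfRep hF ψ).hom := by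
    intro ψ
    have sp := Level.lift_spec (toPfRep hF ψ).L M hr (toPfRep hF ψ).hom
    rw [← frob_frobTrans hF B hr.2, ← Category.assoc, ← frob_toPfRep, Category.assoc]
    congr 1
    exact sp.symm
  rw [key φ, key χ, e]

/-- **`C → C^pf` is faithful** for `C` of perfect type (Frobenius-type arrows are right-cancellable in a
Frobenioid of perfect type, `cancel_frobeniusType`). [cite: MochizukiFrdI2008, Prop. 3.2 (iii) p.59] -/
theorem toPf_faithful (hP : IsOfPerfectType F) : (toPf hF).Faithful :=
  ⟨fun {_ B} _ _ h => by
    obtain ⟨b, hb⟩ := exists_comp_frob_eq_of_map_eq h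
    exact cancel_frobeniusType hF hP (isFrobeniusType_frob hF B b) hb⟩

/-! ### Fullness -/

/-- The image of a descended arrow: if `ψ ≫ (B → B^{(b)}) = (A → A^{(a)}) ≫ θ` for the CHOSEN
Frobenius-type arrows, then `toPf ψ` is the class of `θ` at the level `(a, b)`.
[cite: MochizukiFrdI2008, Def. 3.1 (iii) p.57] -/
theorem map_eq_mk_of_descent {A B : C} {a b : ℕ+} (hab : (root hF A 1).idx * a = (root hF B 1).idx * b)
    (θ : frobPow hF A a ⟶ frobPow hF B b) (ψ : A ⟶ B) (hψ : ψ ≫ frob hF B b = frob hF A a ≫ θ) :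
    (toPf hF).map ψ = Hom.mk ⟨⟨a, b, hab⟩, θ⟩ := by
  change Hom.mk (toPfRep hF ψ) = Hom.mk _
  apply Hom.mk_eq_mk.mpr
  refine ⟨⟨a, b, hab⟩, ⟨one_dvd a, one_dvd b⟩, Level.le_rfl _, ?_⟩
  rw [Level.lift_rfl]
  symm
  apply Level.lift_unique
  haveI := epi_frob hF A 1
  rw [← cancel_epi (frob hF A 1), ← Category.assoc, frob_frobTrans, ← hψ, ← Category.assoc, frob_toPfRep,
    Category.assoc, frob_frobTrans]

/-- **`C → C^pf` is full** for `C` of perfect type: a representative `θ : A^{(a)} → B^{(a)}` of an arrow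
`(A, 1) → (B, 1)` descends along `A → A^{(a)}`, `B → B^{(a)}` (`exists_descent`, Prop. 2.1 (iii)).
[cite: MochizukiFrdI2008, Prop. 3.2 (iii) p.59] -/
theorem toPf_full (hP : IsOfPerfectType F) : (toPf hF).Full :=
  ⟨fun {A B} f => by
    obtain ⟨⟨⟨a, b, hab⟩, θ⟩, rfl⟩ := Hom.mk_surjective f
    have hab' : a = b := by
      have h : 1 * a = 1 * b := hab
      rwa [one_mul, one_mul] at h
    obtain ⟨ψ, hψ⟩ := exists_descent hF hP (isFrobeniusType_frob hF A a) (isFrobeniusType_frob hF B b)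
      (by rw [degFr_frob, degFr_frob, hab']) θ
    exact ⟨ψ, map_eq_mk_of_descent hab θ ψ hψ⟩⟩

/-! ### Essential surjectivity -/

/-- The chosen degree-one Frobenius-type arrow `B → B^{(1)}` is an isomorphism (essential uniqueness
of Frobenius-type arrows of degree `1`, compared with the identity). [cite: MochizukiFrdI2008, Def. 1.3 (ii) p.24] -/
theorem isIso_frob_one (B : C) : IsIso (frob hF B 1) := by
  obtain ⟨i, hi⟩ := hF.ii_unique (𝟙 B) (frob hF B 1) (isFrobeniusType_of_isIso F hF.isPreFrobenioid (𝟙 B))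
    (isFrobeniusType_frob hF B 1) (by rw [degFr_id, degFr_frob])
  rw [← hi, Category.id_comp]
  infer_instance

/-- **`(B, m) ≅ (A, 1)` for an `m`-th root `ρ : A → B`** (of Frobenius type, degree `m`): `B ≅ A^{(m)}` under
`A` (Def. 1.3 (ii)), and the class at level `(m, 1)` of the isomorphism `A^{(m)} ≅ B ≅ B^{(1)}` is an
isomorphism of `C^pf`. [cite: MochizukiFrdI2008, Def. 3.1 (iii) p.57] -/
theorem exists_iso_root_of_isFrobeniusType {A B : C} (ρ : A ⟶ B) (hρ : IsFrobeniusType F ρ) :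
    Nonempty ((toPf hF).obj A ≅ root hF B (degFr F ρ)) := by
  obtain ⟨j, -⟩ := hF.ii_unique ρ (frob hF A (degFr F ρ)) hρ (isFrobeniusType_frob hF A _)
    (by rw [degFr_frob])
  haveI := isIso_frob_one (hF := hF) B
  let e : Rep (root hF A 1) (root hF B (degFr F ρ)) :=
    ⟨⟨degFr F ρ, 1, by rw [one_mul, mul_one]⟩, j.inv ≫ frob hF B 1⟩
  haveI : IsIso (X := root hF A 1) (Y := root hF B (degFr F ρ)) (Hom.mk e) :=
    isIso_mk_of_isIso e (by change IsIso (j.inv ≫ frob hF B 1); infer_instance)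
  exact ⟨asIso (Hom.mk e : root hF A 1 ⟶ root hF B (degFr F ρ))⟩

/-- **`C → C^pf` is essentially surjective** for `C` of perfect type: `(B, m)` is the image of any
`m`-th root of `B` (which exists, Def. 1.2 (iv)). [cite: MochizukiFrdI2008, Prop. 3.2 (iii) p.59] -/
theorem toPf_essSurj (hP : IsOfPerfectType F) : (toPf hF).EssSurj := by
  refine ⟨fun X => ?_⟩
  obtain ⟨B, m⟩ := X
  obtain ⟨A, ρ, hρ, hρd⟩ := (hP B m).1 B ⟨Iso.refl _⟩
  obtain ⟨i⟩ := exists_iso_root_of_isFrobeniusType (hF := hF) ρ hρ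
  rw [hρd] at i
  exact ⟨A, ⟨i⟩⟩

/-! ### The equivalence -/

/-- **For a Frobenioid of perfect type, the natural functor `C → C^pf`, `A ↦ (A, 1)`, is an equivalence
of categories** — the statement behind "`C^pf ⥲ (C^pf)^pf`" of Prop. 3.2 (iii) (there applied to the
perfect Frobenioid `C^pf`), cf. Prop. 2.1 (iii). [cite: MochizukiFrdI2008, Prop. 3.2 (iii) p.59] -/
theorem toPf_isEquivalence (hF : IsFrobenioid F) (hP : IsOfPerfectType F) : (toPf hF).IsEquivalence :=
  haveI := toPf_faithful (hF := hF) hP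
  haveI := toPf_full (hF := hF) hP
  haveI := toPf_essSurj (hF := hF) hP
  { }

/-- The same for THE perfection datum: the functor `C → C^pf` of `PreFrobenioidData.perfection hF` is an
equivalence when `C` is of perfect type (the shape of the third conjunct of `Prop32iii`, for the datum of `C`
itself). [cite: MochizukiFrdI2008, Prop. 3.2 (iii) p.59] -/
theorem perfection_toPf_isEquivalence (hF : IsFrobenioid F) (hP : IsOfPerfectType F) :
    (PreFrobenioidData.perfection hF).toPf.IsEquivalence :=
  toPf_isEquivalence hF hP

end Perfection

end PreFrobenioid

end Literature.AlgebraicGeometry.Frobenioids
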